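import Summits.QuantumFields.QCD.Theses.QuarksAsStableAction
import Summits.QuantumFields.QCD.Theses.WilsonQuarkChessboard
import Summits.QuantumFields.QCD.Theorems.QuarksAsStableActionCriticalLineDiamagnetismEvenHalfDefs
import Literature.MathematicalPhysics.QuantumLattice.WilsonDiracAP
import Summits.QuantumFields.QCD.Theorems.QuarksAsStableActionCriticalLineDiamagnetismStubHadamardUpper
import Summits.QuantumFields.QCD.Theorems.QuarksAsStableActionCriticalLineDiamagnetismStubFreeDetFormula
import Summits.QuantumFields.QCD.Theorems.QuarksAsStableActionCriticalLineDiamagnetismStubFreeSymbolSum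
import Summits.QuantumFields.QCD.Theorems.QuarksAsStableActionCriticalLineDiamagnetismStubCellIncidence
import Summits.QuantumFields.QCD.Theorems.QuarksAsStableActionCriticalLineDiamagnetismStubQuarkChessboardOfSchwarz
import Summits.QuantumFields.QCD.Theorems.QuarksAsStableActionCriticalLineDiamagnetismStubCellGainOfGauged
import Summits.QuantumFields.QCD.Theorems.QuarksAsStableActionCriticalLineDiamagnetismStubBlochFactorisation
import Summits.QuantumFields.QCD.Theorems.QuarksAsStableActionCriticalLineDiamagnetismStubFreeBlochBlocks
import Summits.QuantumFields.QCD.Theorems.QuarksAsStableActionCriticalLineDiamagnetismStubCellDetFactorisation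
import Summits.QuantumFields.QCD.Theorems.QuarksAsStableActionCriticalLineDiamagnetismStubDetPerturbIR
import Summits.QuantumFields.QCD.Theorems.QuarksAsStableActionCriticalLineDiamagnetismStubLogDetSecondOrder
import Summits.QuantumFields.QCD.Theorems.QuarksAsStableActionCriticalLineDiamagnetismStubDeltaBounds
import Summits.QuantumFields.QCD.Theorems.QuarksAsStableActionCriticalLineDiamagnetismStubBlochLatticeSum
import Summits.QuantumFields.QCD.Theorems.QuarksAsStableActionCriticalLineDiamagnetismStubTilingCellData
import Summits.QuantumFields.QCD.Theorems.QuarksAsStableActionCriticalLineDiamagnetismStubCellGainTilingGlue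
import Summits.QuantumFields.QCD.Theorems.QuarksAsStableActionCriticalLineDiamagnetismStubBlockEstimate
import Summits.QuantumFields.QCD.Theorems.QuarksAsStableActionCriticalLineDiamagnetismStubCellGainCore
import Summits.QuantumFields.QCD.Theorems.QuarksAsStableActionCriticalLineDiamagnetismStubCellRegauge
import Summits.QuantumFields.QCD.Theorems.QuarksAsStableActionCriticalLineDiamagnetismStubBackgroundSchwarz
import Summits.QuantumFields.QCD.Theorems.QuarksAsStableActionCriticalLineDiamagnetismStubTadpole
import Summits.QuantumFields.QCD.Theorems.QuarksAsStableActionCriticalLineDiamagnetismStubUnitaryCellIneq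
import Summits.QuantumFields.QCD.Theorems.QuarksAsStableActionCriticalLineDiamagnetismStubBilinearBounds
import Summits.QuantumFields.QCD.Theorems.QuarksAsStableActionCriticalLineDiamagnetismStubOneLoopMarginOfAux
import Summits.QuantumFields.QCD.Theorems.QuarksAsStableActionCriticalLineDiamagnetismStubTilingCombinatorics
import Summits.QuantumFields.QCD.Theorems.QuarksAsStableActionCriticalLineDiamagnetismStubTwistCounting
import Summits.QuantumFields.QCD.Theorems.QuarksAsStableActionCriticalLineDiamagnetismStubMassLipschitz
import Summits.QuantumFields.QCD.Theorems.QuarksAsStableActionCriticalLineDiamagnetismStubWardKernel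
import Summits.QuantumFields.QCD.Theorems.QuarksAsStableActionCriticalLineDiamagnetismStubBlockMargin3b
import Summits.QuantumFields.QCD.Theorems.QuarksAsStableActionCriticalLineDiamagnetismStubBlockMargin0
import Summits.QuantumFields.QCD.Theorems.QuarksAsStableActionCriticalLineDiamagnetismStubBlockMargin1
import Summits.QuantumFields.QCD.Theorems.QuarksAsStableActionCriticalLineDiamagnetismStubBlockMargin2
import Summits.QuantumFields.QCD.Theorems.QuarksAsStableActionCriticalLineDiamagnetismStubBlockMargin3a
import Summits.QuantumFields.QCD.Theorems.QuarksAsStableActionCriticalLineDiamagnetismStubGaugeCoercive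
import Summits.QuantumFields.QCD.Theorems.QuarksAsStableActionCriticalLineDiamagnetismHessianMarginOfStubsAux
import Summits.QuantumFields.QCD.Theorems.QuarksAsStableActionCriticalLineDiamagnetismStubCornerCounting
import Summits.QuantumFields.QCD.Theorems.QuarksAsStableActionCriticalLineDiamagnetismHessianMarginOfStubsAux2
import Summits.QuantumFields.QCD.Theorems.QuarksAsStableActionCriticalLineDiamagnetismStubOneLoopMargin
import Summits.QuantumFields.QCD.Theorems.QuarksAsStableActionCriticalLineDiamagnetismStubStaticReduction
import Summits.QuantumFields.QCD.Theorems.QuarksAsStableActionCriticalLineDiamagnetismStubStaticCovariance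
import Summits.QuantumFields.QCD.Theorems.QuarksAsStableActionCriticalLineDiamagnetismStubFrequencyDiamagnetism
import Summits.QuantumFields.QCD.Theorems.QuarksAsStableActionCriticalLineDiamagnetismStubFrequencyFactorisation

/-!
# Line `Sketch` (chessboard / cell-gain sub-line) — skeleton v25 for the crux
`Summit.QuantumFields.QCD.Theses.QuarksAsStableAction.CriticalLineDiamagnetism` (stmt-QuantumFields-9734)

Leads: prover-line-stmt-QuantumFields-9734-0 (v1–v2), -c1-0 (v3–v10), -c2-0 (v11), -c3-0 (v12–v20, 2026-08-16/17).

## v24 (lead c3, 2026-08-17T07:55Z): S2 `stub_frequencyFactorisation` LANDED p145730 and imported — ONE sorry left: S4 `stub_heavyFrequencyGain`.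

## v23 (lead c3, 2026-08-17T07:40Z): S4 `stub_heavyFrequencyGain` RESHAPED (heavy set `cos ω_i ≤ −199/200`, re-registered) so that its cell
certificate is one small box; S5 assembly re-proved for it (inlined); Route-B helpers landed: DefectRemoval p144030, Pressure p144593,
closedSlabPackaging p145267, mixedSchwarzDet p145594, RectFreqOpDefs p145034. Sorries: S2 (worker), S4 (lead).

## v22 (lead c3, 2026-08-17T07Z): static route LANDING — S1 `stub_staticReduction` p144090, S0 `stub_staticCovariance` p144761, S3 `stub_frequencyDiamagnetism`
p144697 (+Aux1 p144095 defs freqOp/tfreqOp/oneStep, Aux2 p144272 transfer form, Aux3 p144526 static slice bound) LANDED and imported; S5 `stub_twoStaticGain`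
CLOSED in-skeleton by the worker's assembly `twoStaticGain_of_frequencyStubs` (inlined); open: S2 `stub_frequencyFactorisation` (worker, Aux landed
p144750), S4 `stub_heavyFrequencyGain` (lead, Route B: helpers DefectRemoval p144030, Pressure p144593 landed; evenCycleChessboard / mixedSchwarzDet /
closedSlabPackaging delegated). v21 = six stubs registered, `stub_oddHalf` derived. v20 = `stub_oddHalf` a bare sorry.

## v20 (lead c3, 2026-08-17): THE EVEN HALF IS A TREE THEOREM
Every stub of v11–v19 has LANDED under `Summits/QuantumFields/QCD/Theorems/QuarksAsStableActionCriticalLineDiamagnetism*.lean`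
(all `--supports stmt-QuantumFields-9734`; the block margins P0–P3a and everything above them are `--computational`, resting on the
`native_decide` certificates `…CheckerCert0–3`):
wave 1 `stub_unitaryCellIneq` p128572 · `stub_bilinearBounds` p128342 · `stub_tilingCombinatorics` p129950 · aux p128862 ·
wave 2 `stub_wardKernel` p130817 · `stub_gaugeCoercive` p130928 · `stub_massLipschitz` p130805 · `stub_twistCounting` p130758 ·
`stub_cornerCounting` p131847 · aux p131004 p131859 p131941 · wave 2b `stub_blockHessianFormula` p133174 (aux p132295 p132993) ·
wave 3 `stub_cornerEntryBound` p134169 · `stub_blockReduction` p134526 (aux p134254) · `stub_blockClosedForm` p134685 ·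
Literature `Analysis/ValidatedNumerics/AffineArithmetic(Inv)` p134563 p134864 · `stub_blockMargin3b` p135165 ·
checker `…CheckerDefs` p135523 `…CheckerSound` p135787 `…CheckerEvalDefs` p135788 `…CheckerSymm` p136167 `…CheckerEvalSound` p136743
`…CheckerEvalSoundB` p136829 · certificates `…CheckerCert0–3` p136169 p136171 p136172 p136173 · `stub_blockMargin0/1/2/3a` p137670 p137673
p137675 p137676 · Mg `stub_hessianMargin` p138044 · P6 `stub_oneLoopMargin` p139335 · helpers `…EvenHalfDefs` p138009 ·
**`stub_evenHalf` (`…EvenHalf.lean`, p142113): the crux with `Even L →` inserted — PROVED** (inlined below until its olean is served).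
So this file is now: the even half (tree) + the static-route stubs + the merge. `CriticalLineDiamagnetism_of = crux_of_halves stub_evenHalf stub_oddHalf`.

## `stub_oddHalf` (the crux on ODD tori) — engine census (LINE-REPORT-c3.md §ODD HALF, evidence 2026-08-17T04Z)
* covers: `det_AP` on an even cover factorises over twists `t^{2n} = −1`, never `t = −1` — dead;
* mixed site/bond reflection positivity on `ℤ_{2k+1}` (the only route statable over the isotropic `Site 4 L`): new determinant-Schwarz
  block shape (one `ξ/η` plane + one Osterwalder–Seiler bond layer in temporal gauge), an odd-circle chessboard whose closed patterns are
  `(c c̄)^k s(V)` (period-2 tiling + one STATIC defect slab), and a defect-tolerant one-loop analysis WITHOUT the exact Bloch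
  block-diagonalisation (`stub_blochFactorisation`) on which every landed file and the finite certificates rest — XL, a line not a stub set;
* Schatten–Hölder on Lüscher's closed-slab transfer matrices (Ideas/schatten-holder-all-tori, kit j017351 passed): junk-free, but its
  right-hand sides live on the ANISOTROPIC tori `∏_μ (L ± 1)`, not expressible with `GaugeConfig 4 L`; needs new Literature vocabulary,
  SlabTransfer, Schatten–Hölder (absent from Mathlib) and the even half re-typed — a new line.
Cheapest repair (leads c1, c2, c3 concur): the planner restates stmt-9734/9736 with `Even L →` (the bridge consumes AP-even tori only);
then `stub_evenHalf` closes the crux by `crux_of_halves` specialised to the even case (one `exact`).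

## History (v1–v19): see `Lines/Sketch.lean` at commits d779f4c9 (v16), 2d389e77 (v18) and the 2026-08-17T02:52Z publish (v19), and the
Theorems files' docstrings. The composition idea is unchanged since v1: for even `L ≥ L₀`, `|m| ≤ ε`, `U : SU(3)` field, `V = unitaryLift U`:
`‖det_AP U‖ ^ (L⁴) ≤ ∏_c Re dAP (tile c V)` (`QuarkChessboard` = stmt-9306, from `stub_backgroundSchwarz` p122491 + `stub_quarkChessboard_of_schwarz`
p112660), good cells gain (`cellGain_of_stubs` ∘ P6 `stub_oneLoopMargin` ∘ Mg `stub_hessianMargin` ∘ the certified block margins), bad cells pay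
Hadamard (`stub_hadamardUpper`, `stub_freeDetFormula`, `stub_freeSymbolSum`), bookkeeping `stub_cellIncidence`; the `L⁴`-th root is the even
half; `crux_of_halves` merges it with `stub_oddHalf`.
-/

noncomputable section

open scoped BigOperators Classical Matrix ComplexConjugate
open Finset
open Literature.MathematicalPhysics.QuantumLattice Literature.MathematicalPhysics.QuantumFieldTheory
  Literature.Probability.LatticeModels

namespace Summit.QuantumFields.QCD.Cruxes.CriticalLineDiamagnetism.ChessboardCellGain

/-! ## The even half (= `…EvenHalf.lean`, p142113 ACCEPTED; inlined here only until the farm serves its olean — v22 imports it) -/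


/-- Stub 2 of v1/v2 (`cellGain`), verbatim, DERIVED from 2a, 3g, 3h, 3z (landed) and P6. -/
theorem cellGain_of_stubs :
    ∃ δ₀ c K₀ ε : ℝ, 0 < δ₀ ∧ 0 < c ∧ 0 < ε ∧ ∃ L₀ : ℕ, ∀ (L : ℕ) [NeZero L], Even L → L₀ ≤ L →
    let dAP : GaugeConfig 4 L (Matrix.unitaryGroup (Fin 3) ℂ) → ℝ → ℂ := fun V m =>
      (wilsonDirac (unitaryFundamentalRep (Fin 3) ℂ)
        (fun e => if (e.1 e.2).val + 1 = L then -V e else V e) m 1).det;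
    let tile : Site 4 L → GaugeConfig 4 L (Matrix.unitaryGroup (Fin 3) ℂ) →
        GaugeConfig 4 L (Matrix.unitaryGroup (Fin 3) ℂ) := fun c V e =>
      if (e.1 e.2 - c e.2).val % 2 = 0 then V (fun ν => c ν + (((e.1 ν - c ν).val % 2 : ℕ) : ZMod L), e.2)
      else (V (fun ν => c ν + (((Site.shift e.1 e.2 ν - c ν).val % 2 : ℕ) : ZMod L), e.2))⁻¹;
    let dfc : GaugeConfig 4 L (Matrix.unitaryGroup (Fin 3) ℂ) → Plaquette 4 L → ℝ := fun V p =>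
      3 - (unitaryFundamentalRep (Fin 3) ℂ (plaquetteHolonomy V p.1 p.2.1.1 p.2.1.2)).trace.re;
    let inCell : Site 4 L → Plaquette 4 L → Prop := fun c p =>
      p.1 p.2.1.1 = c p.2.1.1 ∧ p.1 p.2.1.2 = c p.2.1.2 ∧
        ∀ ν, ν ≠ p.2.1.1 → ν ≠ p.2.1.2 → (p.1 ν = c ν ∨ p.1 ν = c ν + 1);
    ∀ (V : GaugeConfig 4 L (Matrix.unitaryGroup (Fin 3) ℂ)) (cell : Site 4 L) (m : ℝ), |m| ≤ ε →
      (∀ p, inCell cell p → dfc V p < δ₀) →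
        (dAP (tile cell V) m).re ≤
          Real.exp (K₀ - c * ((L : ℝ) ^ 4 / 4) * ∑ p ∈ univ.filter (fun p => inCell cell p), dfc V p) *
            ‖dAP 1 m‖ :=
  stub_cellGain_of_gauged
    (stub_cellGainTilingGlue (stub_cellRegauge (stub_cellGainCore stub_oneLoopMargin)))


/-- **The even half of the crux** (registered helper `stub_evenHalf`): the crux statement with `Even L →` inserted. -/
theorem stub_evenHalf : ∃ ε δ c₁ K C : ℝ, 0 < ε ∧ 0 < δ ∧ 0 < c₁ ∧ ∃ L₀ : ℕ, ∀ (L : ℕ) [NeZero L], Even L → L₀ ≤ L → let apDet : Literature.MathematicalPhysics.QuantumFieldTheory.GaugeConfig 4 L (Matrix.specialUnitaryGroup (Fin 3) ℂ) → ℝ → ℂ := fun U m => Literature.MathematicalPhysics.QuantumLattice.fermionDet (Literature.MathematicalPhysics.QuantumLattice.wilsonDirac (Literature.MathematicalPhysics.QuantumLattice.unitaryFundamentalRep (Fin 3) ℂ) (fun e => if e.1 e.2 = -1 then -(⟨(U e).1, Matrix.specialUnitaryGroup_le_unitaryGroup (U e).2⟩ : Matrix.unitaryGroup (Fin 3) ℂ)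 else ⟨(U e).1, Matrix.specialUnitaryGroup_le_unitaryGroup (U e).2⟩) m 1); let dfc : Literature.MathematicalPhysics.QuantumFieldTheory.GaugeConfig 4 L (Matrix.specialUnitaryGroup (Fin 3) ℂ) → Literature.MathematicalPhysics.QuantumFieldTheory.Plaquette 4 L → ℝ := fun U p => 3 - (Literature.MathematicalPhysics.QuantumLattice.fundamentalRep (Fin 3) (Literature.MathematicalPhysics.QuantumFieldTheory.plaquetteHolonomy U p.1 p.2.1.1 p.2.1.2)).trace.re; ∀ m : ℝ, |m| ≤ ε → ∀ U : Literature.MathematicalPhysics.QuantumFieldTheory.GaugeConfig 4 L (Matrix.specialUnitaryGroup (Fin 3) ℂ), ‖apDet U m‖ ≤ Real.exp (K - c₁ * (∑ p ∈ Finset.univ.filter (fun p => dfc U p < δ), dfc U p) + C * ((Finset.univ.filter (fun p => δ ≤ dfc U p)).card : ℝ)) * ‖apDet 1 m‖ := by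
  obtain ⟨δ₀, cg, K₀, ε₁, hδ₀, hcg, hε₁, L₁, hGain⟩ := cellGain_of_stubs
  obtain ⟨h₁, hHad⟩ := stub_hadamardUpper
  obtain ⟨h₂, ε₂, hε₂, L₂, hSym⟩ := stub_freeSymbolSum
  set H₁ : ℝ := max h₁ 0 with hH₁
  set H₂ : ℝ := max h₂ 0 with hH₂
  have hH₁0 : 0 ≤ H₁ := le_max_right _ _
  have hH₂0 : 0 ≤ H₂ := le_max_right _ _
  refine ⟨min ε₁ (min ε₂ (1 / 2)), δ₀, cg, |K₀|, 4 * (H₁ + H₂) + 144 * cg, lt_min hε₁ (lt_min hε₂ (by norm_num)),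
    hδ₀, hcg, max (max L₁ L₂) 4, ?_⟩
  intro L _ hLeven hL apDet dfc m hm U
  show ‖cruxDet U m‖ ≤ Real.exp (|K₀| - cg * (∑ p ∈ Finset.univ.filter (fun p => cruxDfc U p < δ₀), cruxDfc U p) +
    (4 * (H₁ + H₂) + 144 * cg) * ((Finset.univ.filter (fun p => δ₀ ≤ cruxDfc U p)).card : ℝ)) * ‖cruxDet 1 m‖
  -- the constants in range
  have hL₁ : L₁ ≤ L := le_trans (le_trans (le_max_left _ _) (le_max_left _ _)) hL
  have hL₂ : L₂ ≤ L := le_trans (le_trans (le_max_right _ _) (le_max_left _ _)) hL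
  have hL4 : 4 ≤ L := le_trans (le_max_right _ _) hL
  have hL2 : 2 ≤ L := le_trans (by norm_num) hL4
  have hm₁ : |m| ≤ ε₁ := le_trans hm (min_le_left _ _)
  have hm₂ : |m| ≤ ε₂ := le_trans hm (le_trans (min_le_right _ _) (min_le_left _ _))
  have hmhalf : |m| ≤ 1 / 2 := le_trans hm (le_trans (min_le_right _ _) (min_le_right _ _))
  have hm1 : |m| ≤ 1 := le_trans hmhalf (by norm_num)
  have hmneg : -1 < m := by
    have := neg_abs_le m
    linarith
  -- the U(3)-side field and the stubs at this `L`
  set V : GaugeConfig 4 L (Matrix.unitaryGroup (Fin 3) ℂ) := unitaryLift U with hV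
  have hG : ∀ (W : GaugeConfig 4 L (Matrix.unitaryGroup (Fin 3) ℂ)) (c : Site 4 L) (m' : ℝ), |m'| ≤ ε₁ →
      (∀ p, inCell c p → dfc3 W p < δ₀) →
        (dAP3 (tile3 c W) m').re ≤
          Real.exp (K₀ - cg * ((L : ℝ) ^ 4 / 4) * ∑ p ∈ univ.filter (fun p => inCell c p), dfc3 W p) * ‖dAP3 1 m'‖ :=
    fun W c m' hm' hgood => hGain L hLeven hL₁ W c m' hm' hgood
  have hH : ∀ (W : GaugeConfig 4 L (Matrix.unitaryGroup (Fin 3) ℂ)) (m' : ℝ), |m'| ≤ 1 →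
      ‖dAP3 W m'‖ ≤ Real.exp (h₁ * (L : ℝ) ^ 4) := fun W m' hm' => hHad L W m' hm'
  have hQC := stub_quarkChessboard_of_schwarz stub_backgroundSchwarz 3 L hLeven hL4 V m hmneg
  simp only [] at hQC
  obtain ⟨hReal', hChess'⟩ := hQC
  have hReal : ∀ c : Site 4 L, 0 ≤ (dAP3 (tile3 c V) m).re := fun c => (hReal' c).1
  have hChess : ‖dAP3 V m‖ ^ (L ^ 4) ≤ ∏ c : Site 4 L, (dAP3 (tile3 c V) m).re := hChess'
  have hInc := stub_cellIncidence L hL2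
  simp only [] at hInc
  obtain ⟨hCellCard', hFour'⟩ := hInc
  have hCellCard : ∀ c : Site 4 L, (univ.filter (fun p => inCell c p)).card ≤ 24 := fun c => hCellCard' c
  have hFour : ∀ p : Plaquette 4 L, (univ.filter (fun c => inCell c p)).card = 4 := fun p => hFour' p
  -- the free determinant from below
  set F : ℝ := ‖dAP3 (1 : GaugeConfig 4 L (Matrix.unitaryGroup (Fin 3) ℂ)) m‖ with hF
  have hFprod : F = ∏ k : Site 4 L,
        ((m + ∑ μ : Fin 4, (1 - Real.cos ((2 * ((k μ).val : ℝ) + 1) * Real.pi / L))) ^ 2 +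
            ∑ μ : Fin 4, Real.sin ((2 * ((k μ).val : ℝ) + 1) * Real.pi / L) ^ 2) ^ 6 := by
    have hsq : F ^ 2 = ∏ k : Site 4 L,
        ((m + ∑ μ : Fin 4, (1 - Real.cos ((2 * ((k μ).val : ℝ) + 1) * Real.pi / L))) ^ 2 +
            ∑ μ : Fin 4, Real.sin ((2 * ((k μ).val : ℝ) + 1) * Real.pi / L) ^ 2) ^ 12 :=
      stub_freeDetFormula L m
    have hP0 : 0 ≤ ∏ k : Site 4 L,
        ((m + ∑ μ : Fin 4, (1 - Real.cos ((2 * ((k μ).val : ℝ) + 1) * Real.pi / L))) ^ 2 +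
            ∑ μ : Fin 4, Real.sin ((2 * ((k μ).val : ℝ) + 1) * Real.pi / L) ^ 2) ^ 6 :=
      Finset.prod_nonneg fun k _ => by positivity
    refine (pow_left_inj₀ (norm_nonneg _) hP0 two_ne_zero).1 ?_
    rw [hsq, ← Finset.prod_pow]
    refine Finset.prod_congr rfl fun k _ => ?_
    ring
  have hFlow : Real.exp (-(H₂ * (L : ℝ) ^ 4)) ≤ F := by
    calc Real.exp (-(H₂ * (L : ℝ) ^ 4)) ≤ Real.exp (-(h₂ * (L : ℝ) ^ 4)) := by
          apply Real.exp_le_exp.2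
          have : h₂ * (L : ℝ) ^ 4 ≤ H₂ * (L : ℝ) ^ 4 :=
            mul_le_mul_of_nonneg_right (le_max_left _ _) (by positivity)
          linarith
      _ ≤ F := by rw [hFprod]; exact hSym L hL₂ m hm₂
  have hFpos : 0 < F := lt_of_lt_of_le (Real.exp_pos _) hFlow
  -- cellwise bound
  have hcell : ∀ c, (dAP3 (tile3 c V) m).re ≤ Real.exp (cellExp K₀ cg (H₁ + H₂) δ₀ V c) * F := by
    intro c
    by_cases hg : goodCell δ₀ V c
    · have h := hG V c m hm₁ hg
      simp only [cellExp, if_pos hg]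
      exact h
    · simp only [cellExp, if_neg hg]
      calc (dAP3 (tile3 c V) m).re ≤ ‖dAP3 (tile3 c V) m‖ := Complex.re_le_norm _
        _ ≤ Real.exp (h₁ * (L : ℝ) ^ 4) := hH (tile3 c V) m hm1
        _ ≤ Real.exp (H₁ * (L : ℝ) ^ 4) :=
          Real.exp_le_exp.2 (mul_le_mul_of_nonneg_right (le_max_left _ _) (by positivity))
        _ = Real.exp (H₁ * (L : ℝ) ^ 4) * (Real.exp (H₂ * (L : ℝ) ^ 4) * Real.exp (-(H₂ * (L : ℝ) ^ 4))) := by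
          rw [← Real.exp_add, add_neg_cancel, Real.exp_zero, mul_one]
        _ ≤ Real.exp (H₁ * (L : ℝ) ^ 4) * (Real.exp (H₂ * (L : ℝ) ^ 4) * F) := by
          gcongr
        _ = Real.exp ((H₁ + H₂) * (L : ℝ) ^ 4) * F := by
          rw [add_mul, Real.exp_add]; ring
  -- product over cells
  have hprod : ∏ c : Site 4 L, (dAP3 (tile3 c V) m).re ≤
      Real.exp (∑ c : Site 4 L, cellExp K₀ cg (H₁ + H₂) δ₀ V c) * F ^ (L ^ 4) := by
    calc ∏ c : Site 4 L, (dAP3 (tile3 c V) m).re ≤ ∏ c : Site 4 L, (Real.exp (cellExp K₀ cg (H₁ + H₂) δ₀ V c) * F) :=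
          Finset.prod_le_prod (fun c _ => hReal c) (fun c _ => hcell c)
      _ = Real.exp (∑ c : Site 4 L, cellExp K₀ cg (H₁ + H₂) δ₀ V c) * F ^ (L ^ 4) := by
          rw [Finset.prod_mul_distrib, Real.exp_sum, Finset.prod_const, Finset.card_univ, card_site]
  -- the exponent estimate
  set E : ℝ := |K₀| - cg * (∑ p ∈ univ.filter (fun p => dfc3 V p < δ₀), dfc3 V p) +
      (4 * (H₁ + H₂) + 144 * cg) * ((univ.filter (fun p => δ₀ ≤ dfc3 V p)).card : ℝ) with hE
  have hex : ∑ c : Site 4 L, cellExp K₀ cg (H₁ + H₂) δ₀ V c ≤ (L : ℝ) ^ 4 * E :=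
    sum_cellExp_le K₀ cg (H₁ + H₂) δ₀ hcg.le (add_nonneg hH₁0 hH₂0) V hCellCard hFour
  -- assemble: L⁴-th power, then root
  have hpow : ‖dAP3 V m‖ ^ (L ^ 4) ≤ (Real.exp E * F) ^ (L ^ 4) := by
    calc ‖dAP3 V m‖ ^ (L ^ 4) ≤ ∏ c : Site 4 L, (dAP3 (tile3 c V) m).re := hChess
      _ ≤ Real.exp (∑ c : Site 4 L, cellExp K₀ cg (H₁ + H₂) δ₀ V c) * F ^ (L ^ 4) := hprod
      _ ≤ Real.exp ((L : ℝ) ^ 4 * E) * F ^ (L ^ 4) := by gcongr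
      _ = (Real.exp E * F) ^ (L ^ 4) := by
          rw [mul_pow, ← Real.exp_nat_mul]; push_cast; ring_nf
  have hL40 : L ^ 4 ≠ 0 := pow_ne_zero 4 (NeZero.ne L)
  have hroot : ‖dAP3 V m‖ ≤ Real.exp E * F :=
    (pow_le_pow_iff_left₀ (norm_nonneg _) (by positivity) hL40).1 hpow
  -- back to the crux's notation
  have hdfc : ∀ p, cruxDfc U p = dfc3 V p := fun p => by rw [hV]; exact cruxDfc_eq U p
  simp only [hdfc]
  rw [cruxDet_eq, cruxDet_one, ← hV]
  exact hroot


/-! ## Registered stubs (`sorry` lives only here; signatures over tree vocabulary only)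

All stubs of v1–v19 have LANDED (list in the module docstring); the even half is the tree theorem `stub_evenHalf`.
Open (v21): the six stubs of the static route to the odd half. -/

/-! ### v21 (lead c3, 2026-08-17): the STATIC ROUTE to the odd half — six registered stubs, `stub_oddHalf` DERIVED

ENGINE (tree theorems of the sibling cruxes 9736/9737, all accepted): Lüscher's transfer form `wilson_det_transfer_form`,
the Fock functor `trace_fockLift`, the cyclic Hölder inequality on odd cycles `stub_cyclicHolder` (extremal words are STATIC,
period one — parity-blind), the static slice bound `stub_staticSliceBound` / `staticIterate_axisBound`:
`‖det D_W[V]‖^L ≤ ∏_s ‖det D_W[S^μ_s V]‖` for EVERY `U(3)` field on an odd torus.  Two static slice bounds (directions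
complementary to a gain orientation `(μ,ν)`) reduce the crux on odd tori to DOUBLY STATIC fields = lifted 2D fields, whose
determinant factorises over the `L²` antiperiodic frequency pairs into 2D frequency operators
`D²_ω[A] = N_ω − H_A`, `N_ω = m+4−cos ω₀−cos ω₁ + i(γ₀ sin ω₀ + γ₁ sin ω₁)`; light frequencies are diamagnetic
(`≤ free`, the 9736 pipeline run in 2D), heavy ones (`cos ω₀, cos ω₁ ≤ −7/10`) GAIN by a convergent walk expansion.
Numerics (lead folder numerics/static2d, kit j022864/j022935): every frequency diamagnetic for haar/smooth/flat-holonomy 2D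
fields at L = 3, 5; c_eff = −F/(L²S) = 0.014–0.016 (L = 5).
Composition: `stub_oddHalf := stub_staticReduction (stub_staticCovariance stub_twoStaticGain)` and, inside
`stub_twoStaticGain` (assembly, worker): `stub_frequencyFactorisation`, `stub_frequencyDiamagnetism`, `stub_heavyFrequencyGain`. -/

/-! `stub_frequencyFactorisation`: LANDED p145730 (imported above). -/

/-! `stub_frequencyDiamagnetism`: LANDED (imported above). -/

/-- **S4 `stub_heavyFrequencyGain`** — at the HEAVY frequencies (`cos ω₀, cos ω₁ ≤ −199/200`, i.e. `|ω_i − π| ≲ 1/10`, effective mass `≥ m + 5.99`)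
the 2D frequency determinant GAINS from every good plaquette and pays at most `C` per bad one, up to a `1/L²` slack for
walks winding around the torus: non-backtracking walk expansion of `log det(N_ω − H_A)` (immediate reversals vanish for
`r = 1`: `P₋^μ V P₊^μ Vᴴ = 0`; turn factor `‖P^νP^μ‖ = 2^(-1/2)`; absolutely convergent for `ρ_ω > 1 + √2`), exact
plaquette (`n = 4`) and rectangle (`n = 6`) terms, homotopy (non-abelian Stokes) bound `3 − Re tr hol(ℓ) ≤ |A(ℓ)| Σ_p |w_ℓ(p)| dfc_p`
for the rest, tail from `n = 8`. [difficulty: XL] -/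
theorem stub_heavyFrequencyGain : ∃ δ c C : ℝ, 0 < δ ∧ 0 < c ∧ ∃ L₀ : ℕ, ∀ (L : ℕ) [NeZero L], Odd L → L₀ ≤ L →
    ∀ (A : ZMod L → ZMod L → Fin 4 → Matrix.unitaryGroup (Fin 3) ℂ) (m : ℝ), |m| ≤ 1 / 10 → ∀ ω₀ ω₁ : ℝ,
    Real.cos ω₀ ≤ -(199 / 200) → Real.cos ω₁ ≤ -(199 / 200) →
    let fD := fun (A : ZMod L → ZMod L → Fin 4 → Matrix.unitaryGroup (Fin 3) ℂ) (m ω₀ ω₁ : ℝ) =>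
      Matrix.of fun (p q : (ZMod L × ZMod L) × Fin 3 × Fin 4) =>
        (if p.1 = q.1 ∧ p.2.1 = q.2.1 then
            (((m + 4 - Real.cos ω₀ - Real.cos ω₁ : ℝ) : ℂ) * (1 : Matrix (Fin 4) (Fin 4) ℂ) p.2.2 q.2.2 +
              Complex.I * (((Real.sin ω₀ : ℝ) : ℂ) * euclideanGamma 0 p.2.2 q.2.2 +
                ((Real.sin ω₁ : ℝ) : ℂ) * euclideanGamma 1 p.2.2 q.2.2))
          else 0) -
          (1 / 2 : ℂ) *
            ((if q.1 = (p.1.1 + 1, p.1.2) then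
                ((1 : Matrix (Fin 4) (Fin 4) ℂ) - euclideanGamma 2) p.2.2 q.2.2 *
                  ((if p.1.1 = -1 then (-1 : ℂ) else 1) * (A p.1.1 p.1.2 2 : Matrix (Fin 3) (Fin 3) ℂ) p.2.1 q.2.1)
              else 0) +
             (if p.1 = (q.1.1 + 1, q.1.2) then
                ((1 : Matrix (Fin 4) (Fin 4) ℂ) + euclideanGamma 2) p.2.2 q.2.2 *
                  ((if q.1.1 = -1 then (-1 : ℂ) else 1) * (star (A q.1.1 q.1.2 2 : Matrix (Fin 3) (Fin 3) ℂ)) p.2.1 q.2.1)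
              else 0) +
             (if q.1 = (p.1.1, p.1.2 + 1) then
                ((1 : Matrix (Fin 4) (Fin 4) ℂ) - euclideanGamma 3) p.2.2 q.2.2 *
                  ((if p.1.2 = -1 then (-1 : ℂ) else 1) * (A p.1.1 p.1.2 3 : Matrix (Fin 3) (Fin 3) ℂ) p.2.1 q.2.1)
              else 0) +
             (if p.1 = (q.1.1, q.1.2 + 1) then
                ((1 : Matrix (Fin 4) (Fin 4) ℂ) + euclideanGamma 3) p.2.2 q.2.2 *
                  ((if q.1.2 = -1 then (-1 : ℂ) else 1) * (star (A q.1.1 q.1.2 3 : Matrix (Fin 3) (Fin 3) ℂ)) p.2.1 q.2.1)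
              else 0));
    let dfc2 := fun (A : ZMod L → ZMod L → Fin 4 → Matrix.unitaryGroup (Fin 3) ℂ) (a b : ZMod L) =>
      3 - ((A a b 2 : Matrix (Fin 3) (Fin 3) ℂ) * (A (a + 1) b 3 : Matrix (Fin 3) (Fin 3) ℂ) *
        star (A a (b + 1) 2 : Matrix (Fin 3) (Fin 3) ℂ) * star (A a b 3 : Matrix (Fin 3) (Fin 3) ℂ)).trace.re;
    ‖(fD A m ω₀ ω₁).det‖ ≤
      Real.exp (1 / (L : ℝ) ^ 2 - c * (∑ ab ∈ (Finset.univ : Finset (ZMod L × ZMod L)).filter (fun ab => dfc2 A ab.1 ab.2 < δ), dfc2 A ab.1 ab.2)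
        + C * (((Finset.univ : Finset (ZMod L × ZMod L)).filter (fun ab => δ ≤ dfc2 A ab.1 ab.2)).card : ℝ)) *
      ‖(fD (fun _ _ _ => 1) m ω₀ ω₁).det‖ := by
  sorry


/-! ### S5 assembly (worker wave 4, rc 0; inlined: hypothesis form > 4000 chars cannot be registered) -/


namespace TwoStaticGain

/-! ## Elementary bookkeeping -/

/-- Product bookkeeping: `0 ≤ f ≤ g` everywhere and `f ≤ exp E · g` on the set `{P}` give
`∏ f ≤ exp (#{P} · min 0 E) · ∏ g`. -/
theorem prod_le_exp_mul_prod {ι : Type*} [Fintype ι] (P : ι → Prop) [DecidablePred P]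
    (f g : ι → ℝ) (E : ℝ) (hf : ∀ k, 0 ≤ f k) (hfg : ∀ k, f k ≤ g k)
    (hP : ∀ k, P k → f k ≤ Real.exp E * g k) :
    ∏ k, f k ≤ Real.exp (((univ.filter P).card : ℝ) * min 0 E) * ∏ k, g k := by
  have key : ∀ k, f k ≤ (if P k then Real.exp (min 0 E) else 1) * g k := by
    intro k
    split_ifs with hk
    · rcases le_or_gt 0 E with hE | hE
      · rw [min_eq_left hE, Real.exp_zero, one_mul]
        exact hfg k
      · rw [min_eq_right hE.le]
        exact hP k hk
    · rw [one_mul]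
      exact hfg k
  calc ∏ k, f k ≤ ∏ k, (if P k then Real.exp (min 0 E) else 1) * g k :=
        Finset.prod_le_prod (fun k _ => hf k) fun k _ => key k
    _ = (∏ k, (if P k then Real.exp (min 0 E) else 1)) * ∏ k, g k := Finset.prod_mul_distrib
    _ = Real.exp (min 0 E) ^ (univ.filter P).card * ∏ k, g k := by
        rw [Finset.prod_ite, Finset.prod_const, Finset.prod_const_one, mul_one]
    _ = Real.exp (((univ.filter P).card : ℝ) * min 0 E) * ∏ k, g k := by
        rw [← Real.exp_nat_mul]

/-- Exponent bookkeeping: with `L²/10⁴ ≤ h ≤ L²`,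
`h · min 0 (1/L² − cS + CN) ≤ 1 − (c/10⁴) L² S + (max C 0) L² N`. -/
theorem exponent_le (Lsq h c C S N : ℝ) (hc : 0 ≤ c) (hN : 0 ≤ N) (hh : 0 ≤ h) (hhL : h ≤ Lsq)
    (hLh : Lsq / 10000 ≤ h) (hL : 0 < Lsq) :
    h * min 0 (1 / Lsq - c * S + C * N) ≤ 1 - c / 10000 * Lsq * S + max C 0 * Lsq * N := by
  have hC : C ≤ max C 0 := le_max_left _ _
  have hC0 : 0 ≤ max C 0 := le_max_right _ _
  have h3 : 0 ≤ max C 0 * Lsq * N := mul_nonneg (mul_nonneg hC0 hL.le) hN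
  rcases le_or_gt S 0 with hS | hS
  · have h1 : h * min 0 (1 / Lsq - c * S + C * N) ≤ 0 :=
      mul_nonpos_iff.2 (Or.inl ⟨hh, min_le_left _ _⟩)
    have h2 : c / 10000 * Lsq * S ≤ 0 :=
      mul_nonpos_iff.2 (Or.inl ⟨mul_nonneg (div_nonneg hc (by norm_num)) hL.le, hS⟩)
    linarith
  · have h1 : h * min 0 (1 / Lsq - c * S + C * N) ≤ h * (1 / Lsq - c * S + C * N) :=
      mul_le_mul_of_nonneg_left (min_le_right _ _) hh
    have h2 : h * (1 / Lsq) ≤ 1 := by rw [mul_one_div, div_le_one hL]; exact hhL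
    have h4 : c * S * (Lsq / 10000) ≤ c * S * h :=
      mul_le_mul_of_nonneg_left hLh (mul_nonneg hc hS.le)
    have h5 : C * (h * N) ≤ max C 0 * (h * N) := mul_le_mul_of_nonneg_right hC (mul_nonneg hh hN)
    have h6 : max C 0 * N * h ≤ max C 0 * N * Lsq := mul_le_mul_of_nonneg_left hhL (mul_nonneg hC0 hN)
    nlinarith

/-- If `|θ − π| ≤ 1/10` then `cos θ ≤ −199/200` (`cos (1/10) ≥ 1 − 1/200`). -/
theorem cos_le_of_near_pi (θ : ℝ) (h : |θ - Real.pi| ≤ 1 / 10) : Real.cos θ ≤ -(199 / 200) := by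
  have h1 : Real.cos θ = -Real.cos (θ - Real.pi) := by rw [Real.cos_sub_pi, neg_neg]
  have h2 : 1 - (θ - Real.pi) ^ 2 / 2 ≤ Real.cos (θ - Real.pi) := Real.one_sub_sq_div_two_le_cos
  have h3 : (θ - Real.pi) ^ 2 ≤ (1 / 10) ^ 2 := by
    rw [← sq_abs]
    exact pow_le_pow_left₀ (abs_nonneg _) h 2
  rw [h1]
  linarith

/-- One-dimensional count of heavy frequencies: for `L ≥ 200`, at least `L/100` of the `L` antiperiodic
frequencies `π(2k+1)/L` have cosine `≤ −199/200`. -/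
theorem card_heavy_one_dim (L : ℕ) (hL : 200 ≤ L) :
    (L : ℝ) / 100 ≤ ((univ.filter fun k : Fin L =>
      Real.cos (Real.pi * (2 * ((k : ℕ) : ℝ) + 1) / L) ≤ -(199 / 200)).card : ℝ) := by
  have hL0 : 0 < L := by omega
  have hLr : (0 : ℝ) < L := by exact_mod_cast hL0
  have hcount : 2 * (L / 100) + 1 ≤ (univ.filter fun k : Fin L =>
      Real.cos (Real.pi * (2 * ((k : ℕ) : ℝ) + 1) / L) ≤ -(199 / 200)).card := by
    refine Finset.le_card_of_inj_on_range
      (fun j => (⟨(L / 2 - L / 100 + j) % L, Nat.mod_lt _ hL0⟩ : Fin L)) ?_ ?_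
    · intro j hj
      have hlt : L / 2 - L / 100 + j < L := by omega
      rw [Finset.mem_filter]
      refine ⟨Finset.mem_univ _, ?_⟩
      simp only [Nat.mod_eq_of_lt hlt]
      apply cos_le_of_near_pi
      have hup' : (2 * ((L / 2 - L / 100 + j : ℕ) : ℝ) + 1) ≤ L + (2 * ((L / 100 : ℕ) : ℝ) + 1) := by
        exact_mod_cast (show 2 * (L / 2 - L / 100 + j) + 1 ≤ L + (2 * (L / 100) + 1) by omega)
      have hdn' : (L : ℝ) ≤ 2 * ((L / 2 - L / 100 + j : ℕ) : ℝ) + 1 + (2 * ((L / 100 : ℕ) : ℝ) + 1) := by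
        exact_mod_cast (show L ≤ 2 * (L / 2 - L / 100 + j) + 1 + (2 * (L / 100) + 1) by omega)
      have hwin' : (40 : ℝ) * (2 * ((L / 100 : ℕ) : ℝ) + 1) ≤ L := by
        exact_mod_cast (show 40 * (2 * (L / 100) + 1) ≤ L by omega)
      have hkey : Real.pi * (2 * ((L / 100 : ℕ) : ℝ) + 1) ≤ 1 / 10 * L := by
        nlinarith [Real.pi_le_four, Real.pi_pos]
      have heq : Real.pi * (2 * ((L / 2 - L / 100 + j : ℕ) : ℝ) + 1) / L - Real.pi =
          Real.pi * (2 * ((L / 2 - L / 100 + j : ℕ) : ℝ) + 1 - L) / L := by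
        field_simp
      rw [heq, abs_le]
      constructor
      · rw [le_div_iff₀ hLr]
        nlinarith [Real.pi_pos]
      · rw [div_le_iff₀ hLr]
        nlinarith [Real.pi_pos]
    · intro i hi j hj hij
      have := congrArg Fin.val hij
      simp only at this
      rwa [Nat.mod_eq_of_lt (by omega), Nat.mod_eq_of_lt (by omega), add_right_inj] at this
  have h100' : (L : ℝ) ≤ 100 * ((L / 100 : ℕ) : ℝ) + 99 := by
    exact_mod_cast (show L ≤ 100 * (L / 100) + 99 by omega)
  have hLr200 : (200 : ℝ) ≤ L := by exact_mod_cast hL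
  calc (L : ℝ) / 100 ≤ ((2 * (L / 100) + 1 : ℕ) : ℝ) := by push_cast; linarith
    _ ≤ _ := by exact_mod_cast hcount

/-- Two-dimensional count: for `L ≥ 200` at least `L²/10000` of the `L²` frequency pairs are heavy. -/
theorem card_heavy_two_dim (L : ℕ) (hL : 200 ≤ L) :
    (L : ℝ) ^ 2 / 10000 ≤ ((univ.filter fun k : Fin L × Fin L =>
      Real.cos (Real.pi * (2 * ((k.1 : ℕ) : ℝ) + 1) / L) ≤ -(199 / 200) ∧
      Real.cos (Real.pi * (2 * ((k.2 : ℕ) : ℝ) + 1) / L) ≤ -(199 / 200)).card : ℝ) := by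
  have h1 := card_heavy_one_dim L hL
  have hset : (univ.filter fun k : Fin L × Fin L =>
      Real.cos (Real.pi * (2 * ((k.1 : ℕ) : ℝ) + 1) / L) ≤ -(199 / 200) ∧
      Real.cos (Real.pi * (2 * ((k.2 : ℕ) : ℝ) + 1) / L) ≤ -(199 / 200)) =
      (univ.filter fun k : Fin L => Real.cos (Real.pi * (2 * ((k : ℕ) : ℝ) + 1) / L) ≤ -(199 / 200)) ×ˢ
      (univ.filter fun k : Fin L => Real.cos (Real.pi * (2 * ((k : ℕ) : ℝ) + 1) / L) ≤ -(199 / 200)) := by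
    ext k
    simp only [Finset.mem_filter, Finset.mem_univ, true_and, Finset.mem_product]
  rw [hset, Finset.card_product, Nat.cast_mul]
  have h0 : (0 : ℝ) ≤ L / 100 := by positivity
  nlinarith

/-! ## The assembly, abstractly -/

/-- The doubly static gain from the three frequency stubs, for ABSTRACT families: `W L A m` (the Wilson determinant of
the lift of `A`), `WT L m` (that of the all-seams field, `= W L 1 m` by `hT`), `F L A m ω₀ ω₁` (the 2D frequency
determinant) and `D L A a b` (the plaquette deficit).  Constants: `ε = 1/10`, `c' = c/10⁴`, `K = 1`, `C' = max C 0`,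
`L₀' = max L₀ 200`. -/
theorem main
    (W : ∀ (L : ℕ) [NeZero L], (ZMod L → ZMod L → Fin 4 → Matrix.unitaryGroup (Fin 3) ℂ) → ℝ → ℂ)
    (WT : ∀ (L : ℕ) [NeZero L], ℝ → ℂ)
    (F : ∀ (L : ℕ) [NeZero L], (ZMod L → ZMod L → Fin 4 → Matrix.unitaryGroup (Fin 3) ℂ) → ℝ → ℝ → ℝ → ℂ)
    (D : ∀ (L : ℕ), (ZMod L → ZMod L → Fin 4 → Matrix.unitaryGroup (Fin 3) ℂ) → ZMod L → ZMod L → ℝ)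
    (hT : ∀ (L : ℕ) [NeZero L] (m : ℝ), WT L m = W L (fun _ _ _ => 1) m)
    (hF : ∀ (L : ℕ) [NeZero L] (A : ZMod L → ZMod L → Fin 4 → Matrix.unitaryGroup (Fin 3) ℂ) (m : ℝ),
      W L A m = ∏ k₀ : Fin L, ∏ k₁ : Fin L,
        F L A m (Real.pi * (2 * (k₀ : ℕ) + 1) / L) (Real.pi * (2 * (k₁ : ℕ) + 1) / L))
    (hD : ∀ (L : ℕ) [NeZero L], Odd L → ∀ (A : ZMod L → ZMod L → Fin 4 → Matrix.unitaryGroup (Fin 3) ℂ) (m : ℝ), -1 < m →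
      ∀ ω₀ ω₁ : ℝ, ‖F L A m ω₀ ω₁‖ ≤ ‖F L (fun _ _ _ => 1) m ω₀ ω₁‖)
    (hG : ∃ δ c C : ℝ, 0 < δ ∧ 0 < c ∧ ∃ L₀ : ℕ, ∀ (L : ℕ) [NeZero L], Odd L → L₀ ≤ L →
      ∀ (A : ZMod L → ZMod L → Fin 4 → Matrix.unitaryGroup (Fin 3) ℂ) (m : ℝ), |m| ≤ 1 / 10 → ∀ ω₀ ω₁ : ℝ,
      Real.cos ω₀ ≤ -(199 / 200) → Real.cos ω₁ ≤ -(199 / 200) →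
      ‖F L A m ω₀ ω₁‖ ≤
        Real.exp (1 / (L : ℝ) ^ 2
          - c * (∑ ab ∈ (Finset.univ : Finset (ZMod L × ZMod L)).filter (fun ab => D L A ab.1 ab.2 < δ),
              D L A ab.1 ab.2)
          + C * (((Finset.univ : Finset (ZMod L × ZMod L)).filter (fun ab => δ ≤ D L A ab.1 ab.2)).card : ℝ)) *
        ‖F L (fun _ _ _ => 1) m ω₀ ω₁‖) :
    ∃ ε δ c K C : ℝ, 0 < ε ∧ 0 < δ ∧ 0 < c ∧ ∃ L₀ : ℕ, ∀ (L : ℕ) [NeZero L], Odd L → L₀ ≤ L →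
      ∀ (A : ZMod L → ZMod L → Fin 4 → Matrix.unitaryGroup (Fin 3) ℂ) (m : ℝ), |m| ≤ ε →
      ‖W L A m‖ ≤
        Real.exp (K
          - c * (L : ℝ) ^ 2 * (∑ ab ∈ (Finset.univ : Finset (ZMod L × ZMod L)).filter (fun ab => D L A ab.1 ab.2 < δ),
              D L A ab.1 ab.2)
          + C * (L : ℝ) ^ 2 * (((Finset.univ : Finset (ZMod L × ZMod L)).filter (fun ab => δ ≤ D L A ab.1 ab.2)).card : ℝ)) *
        ‖WT L m‖ := by
  obtain ⟨δ, c, C, hδ, hc, L₀, hG⟩ := hG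
  refine ⟨1 / 10, δ, c / 10000, 1, max C 0, by norm_num, hδ, by positivity, max L₀ 200, ?_⟩
  intro L _ hodd hL A m hm
  have hL₀ : L₀ ≤ L := le_of_max_le_left hL
  have h200 : 200 ≤ L := le_of_max_le_right hL
  have hm1 : -1 < m := by have := (abs_le.1 hm).1; linarith
  set θ : Fin L → ℝ := fun k => Real.pi * (2 * (k : ℕ) + 1) / L with hθ
  set f : Fin L × Fin L → ℝ := fun k => ‖F L A m (θ k.1) (θ k.2)‖ with hf
  set g : Fin L × Fin L → ℝ := fun k => ‖F L (fun _ _ _ => 1) m (θ k.1) (θ k.2)‖ with hg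
  set S : ℝ := ∑ ab ∈ (Finset.univ : Finset (ZMod L × ZMod L)).filter (fun ab => D L A ab.1 ab.2 < δ),
    D L A ab.1 ab.2 with hS
  set N : ℝ := (((Finset.univ : Finset (ZMod L × ZMod L)).filter (fun ab => δ ≤ D L A ab.1 ab.2)).card : ℝ)
    with hN
  have hlhs : ‖W L A m‖ = ∏ k, f k := by
    rw [hF L A m, norm_prod, Fintype.prod_prod_type]
    simp only [norm_prod, hf, hθ]
  have hrhs : ‖WT L m‖ = ∏ k, g k := by
    rw [hT L m, hF L _ m, norm_prod, Fintype.prod_prod_type]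
    simp only [norm_prod, hg, hθ]
  have hprod := prod_le_exp_mul_prod
    (fun k : Fin L × Fin L => Real.cos (θ k.1) ≤ -(199 / 200) ∧ Real.cos (θ k.2) ≤ -(199 / 200)) f g
    (1 / (L : ℝ) ^ 2 - c * S + C * N) (fun k => norm_nonneg _)
    (fun k => hD L hodd A m hm1 (θ k.1) (θ k.2))
    (fun k hk => hG L hodd hL₀ A m hm (θ k.1) (θ k.2) hk.1 hk.2)
  have hcard_le : (((Finset.univ : Finset (Fin L × Fin L)).filter
      (fun k : Fin L × Fin L => Real.cos (θ k.1) ≤ -(199 / 200) ∧ Real.cos (θ k.2) ≤ -(199 / 200))).card : ℝ)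
      ≤ (L : ℝ) ^ 2 := by
    have h := Finset.card_filter_le (Finset.univ : Finset (Fin L × Fin L))
      (fun k : Fin L × Fin L => Real.cos (θ k.1) ≤ -(199 / 200) ∧ Real.cos (θ k.2) ≤ -(199 / 200))
    rw [Finset.card_univ, Fintype.card_prod, Fintype.card_fin] at h
    have h' : (((Finset.univ : Finset (Fin L × Fin L)).filter
      (fun k : Fin L × Fin L => Real.cos (θ k.1) ≤ -(199 / 200) ∧ Real.cos (θ k.2) ≤ -(199 / 200))).card : ℝ)
      ≤ ((L * L : ℕ) : ℝ) := by exact_mod_cast h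
    simpa [sq] using h'
  have hcard_ge : (L : ℝ) ^ 2 / 10000 ≤ (((Finset.univ : Finset (Fin L × Fin L)).filter
      (fun k : Fin L × Fin L => Real.cos (θ k.1) ≤ -(199 / 200) ∧ Real.cos (θ k.2) ≤ -(199 / 200))).card : ℝ) :=
    card_heavy_two_dim L h200
  have hexp := exponent_le ((L : ℝ) ^ 2) _ c C S N hc.le (by positivity) (by positivity) hcard_le hcard_ge
    (by positivity)
  calc ‖W L A m‖ = ∏ k, f k := hlhs
    _ ≤ _ := hprod
    _ ≤ Real.exp (1 - c / 10000 * (L : ℝ) ^ 2 * S + max C 0 * (L : ℝ) ^ 2 * N) * ∏ k, g k :=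
        mul_le_mul_of_nonneg_right (Real.exp_le_exp.2 hexp) (Finset.prod_nonneg fun k _ => norm_nonneg _)
    _ = _ := by rw [hrhs]

end TwoStaticGain

/-- **Assembly of `stub_twoStaticGain`** (the doubly static gain) from the registered statements of
`stub_frequencyFactorisation` (`hF`), `stub_frequencyDiamagnetism` (`hD`) and `stub_heavyFrequencyGain` (`hG`):
split the `L²` frequencies into heavy (`cos ≤ −199/200` on both axes: gain, `hG`) and the rest (diamagnetic, `hD`),
`lift 1 = T`, and count `#heavy ≥ L²/10⁴` for `L ≥ 200`.  Constants `ε = 1/10`, `c' = c/10⁴`, `K = 1`, `C' = max C 0`,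
`L₀' = max L₀ 200`. -/
theorem twoStaticGain_of_frequencyStubs
    (hF : ∀ (L : ℕ) [NeZero L] (A : ZMod L → ZMod L → Fin 4 → Matrix.unitaryGroup (Fin 3) ℂ) (m : ℝ),
    let fD := fun (A : ZMod L → ZMod L → Fin 4 → Matrix.unitaryGroup (Fin 3) ℂ) (m ω₀ ω₁ : ℝ) =>
      Matrix.of fun (p q : (ZMod L × ZMod L) × Fin 3 × Fin 4) =>
        (if p.1 = q.1 ∧ p.2.1 = q.2.1 then
            (((m + 4 - Real.cos ω₀ - Real.cos ω₁ : ℝ) : ℂ) * (1 : Matrix (Fin 4) (Fin 4) ℂ) p.2.2 q.2.2 +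
              Complex.I * (((Real.sin ω₀ : ℝ) : ℂ) * euclideanGamma 0 p.2.2 q.2.2 +
                ((Real.sin ω₁ : ℝ) : ℂ) * euclideanGamma 1 p.2.2 q.2.2))
          else 0) -
          (1 / 2 : ℂ) *
            ((if q.1 = (p.1.1 + 1, p.1.2) then
                ((1 : Matrix (Fin 4) (Fin 4) ℂ) - euclideanGamma 2) p.2.2 q.2.2 *
                  ((if p.1.1 = -1 then (-1 : ℂ) else 1) * (A p.1.1 p.1.2 2 : Matrix (Fin 3) (Fin 3) ℂ) p.2.1 q.2.1)
              else 0) +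
             (if p.1 = (q.1.1 + 1, q.1.2) then
                ((1 : Matrix (Fin 4) (Fin 4) ℂ) + euclideanGamma 2) p.2.2 q.2.2 *
                  ((if q.1.1 = -1 then (-1 : ℂ) else 1) * (star (A q.1.1 q.1.2 2 : Matrix (Fin 3) (Fin 3) ℂ)) p.2.1 q.2.1)
              else 0) +
             (if q.1 = (p.1.1, p.1.2 + 1) then
                ((1 : Matrix (Fin 4) (Fin 4) ℂ) - euclideanGamma 3) p.2.2 q.2.2 *
                  ((if p.1.2 = -1 then (-1 : ℂ) else 1) * (A p.1.1 p.1.2 3 : Matrix (Fin 3) (Fin 3) ℂ) p.2.1 q.2.1)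
              else 0) +
             (if p.1 = (q.1.1, q.1.2 + 1) then
                ((1 : Matrix (Fin 4) (Fin 4) ℂ) + euclideanGamma 3) p.2.2 q.2.2 *
                  ((if q.1.2 = -1 then (-1 : ℂ) else 1) * (star (A q.1.1 q.1.2 3 : Matrix (Fin 3) (Fin 3) ℂ)) p.2.1 q.2.1)
              else 0));
    let lift := fun (A : ZMod L → ZMod L → Fin 4 → Matrix.unitaryGroup (Fin 3) ℂ) (e : Edge 4 L) =>
      if e.2 = 0 ∨ e.2 = 1 then (if e.1 e.2 = -1 then (-1 : Matrix.unitaryGroup (Fin 3) ℂ) else 1)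
      else (if e.1 e.2 = -1 then -(A (e.1 2) (e.1 3) e.2) else A (e.1 2) (e.1 3) e.2);
    (wilsonDirac (unitaryFundamentalRep (Fin 3) ℂ) (lift A) m 1).det =
      ∏ k₀ : Fin L, ∏ k₁ : Fin L,
        (fD A m (Real.pi * (2 * (k₀ : ℕ) + 1) / L) (Real.pi * (2 * (k₁ : ℕ) + 1) / L)).det)
    (hD : ∀ (L : ℕ) [NeZero L], Odd L →
    ∀ (A : ZMod L → ZMod L → Fin 4 → Matrix.unitaryGroup (Fin 3) ℂ) (m : ℝ), -1 < m → ∀ ω₀ ω₁ : ℝ,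
    let fD := fun (A : ZMod L → ZMod L → Fin 4 → Matrix.unitaryGroup (Fin 3) ℂ) (m ω₀ ω₁ : ℝ) =>
      Matrix.of fun (p q : (ZMod L × ZMod L) × Fin 3 × Fin 4) =>
        (if p.1 = q.1 ∧ p.2.1 = q.2.1 then
            (((m + 4 - Real.cos ω₀ - Real.cos ω₁ : ℝ) : ℂ) * (1 : Matrix (Fin 4) (Fin 4) ℂ) p.2.2 q.2.2 +
              Complex.I * (((Real.sin ω₀ : ℝ) : ℂ) * euclideanGamma 0 p.2.2 q.2.2 +
                ((Real.sin ω₁ : ℝ) : ℂ) * euclideanGamma 1 p.2.2 q.2.2))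
          else 0) -
          (1 / 2 : ℂ) *
            ((if q.1 = (p.1.1 + 1, p.1.2) then
                ((1 : Matrix (Fin 4) (Fin 4) ℂ) - euclideanGamma 2) p.2.2 q.2.2 *
                  ((if p.1.1 = -1 then (-1 : ℂ) else 1) * (A p.1.1 p.1.2 2 : Matrix (Fin 3) (Fin 3) ℂ) p.2.1 q.2.1)
              else 0) +
             (if p.1 = (q.1.1 + 1, q.1.2) then
                ((1 : Matrix (Fin 4) (Fin 4) ℂ) + euclideanGamma 2) p.2.2 q.2.2 *
                  ((if q.1.1 = -1 then (-1 : ℂ) else 1) * (star (A q.1.1 q.1.2 2 : Matrix (Fin 3) (Fin 3) ℂ)) p.2.1 q.2.1)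
              else 0) +
             (if q.1 = (p.1.1, p.1.2 + 1) then
                ((1 : Matrix (Fin 4) (Fin 4) ℂ) - euclideanGamma 3) p.2.2 q.2.2 *
                  ((if p.1.2 = -1 then (-1 : ℂ) else 1) * (A p.1.1 p.1.2 3 : Matrix (Fin 3) (Fin 3) ℂ) p.2.1 q.2.1)
              else 0) +
             (if p.1 = (q.1.1, q.1.2 + 1) then
                ((1 : Matrix (Fin 4) (Fin 4) ℂ) + euclideanGamma 3) p.2.2 q.2.2 *
                  ((if q.1.2 = -1 then (-1 : ℂ) else 1) * (star (A q.1.1 q.1.2 3 : Matrix (Fin 3) (Fin 3) ℂ)) p.2.1 q.2.1)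
              else 0));
    ‖(fD A m ω₀ ω₁).det‖ ≤ ‖(fD (fun _ _ _ => 1) m ω₀ ω₁).det‖)
    (hG : ∃ δ c C : ℝ, 0 < δ ∧ 0 < c ∧ ∃ L₀ : ℕ, ∀ (L : ℕ) [NeZero L], Odd L → L₀ ≤ L →
    ∀ (A : ZMod L → ZMod L → Fin 4 → Matrix.unitaryGroup (Fin 3) ℂ) (m : ℝ), |m| ≤ 1 / 10 → ∀ ω₀ ω₁ : ℝ,
    Real.cos ω₀ ≤ -(199 / 200) → Real.cos ω₁ ≤ -(199 / 200) →
    let fD := fun (A : ZMod L → ZMod L → Fin 4 → Matrix.unitaryGroup (Fin 3) ℂ) (m ω₀ ω₁ : ℝ) =>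
      Matrix.of fun (p q : (ZMod L × ZMod L) × Fin 3 × Fin 4) =>
        (if p.1 = q.1 ∧ p.2.1 = q.2.1 then
            (((m + 4 - Real.cos ω₀ - Real.cos ω₁ : ℝ) : ℂ) * (1 : Matrix (Fin 4) (Fin 4) ℂ) p.2.2 q.2.2 +
              Complex.I * (((Real.sin ω₀ : ℝ) : ℂ) * euclideanGamma 0 p.2.2 q.2.2 +
                ((Real.sin ω₁ : ℝ) : ℂ) * euclideanGamma 1 p.2.2 q.2.2))
          else 0) -
          (1 / 2 : ℂ) *
            ((if q.1 = (p.1.1 + 1, p.1.2) then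
                ((1 : Matrix (Fin 4) (Fin 4) ℂ) - euclideanGamma 2) p.2.2 q.2.2 *
                  ((if p.1.1 = -1 then (-1 : ℂ) else 1) * (A p.1.1 p.1.2 2 : Matrix (Fin 3) (Fin 3) ℂ) p.2.1 q.2.1)
              else 0) +
             (if p.1 = (q.1.1 + 1, q.1.2) then
                ((1 : Matrix (Fin 4) (Fin 4) ℂ) + euclideanGamma 2) p.2.2 q.2.2 *
                  ((if q.1.1 = -1 then (-1 : ℂ) else 1) * (star (A q.1.1 q.1.2 2 : Matrix (Fin 3) (Fin 3) ℂ)) p.2.1 q.2.1)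
              else 0) +
             (if q.1 = (p.1.1, p.1.2 + 1) then
                ((1 : Matrix (Fin 4) (Fin 4) ℂ) - euclideanGamma 3) p.2.2 q.2.2 *
                  ((if p.1.2 = -1 then (-1 : ℂ) else 1) * (A p.1.1 p.1.2 3 : Matrix (Fin 3) (Fin 3) ℂ) p.2.1 q.2.1)
              else 0) +
             (if p.1 = (q.1.1, q.1.2 + 1) then
                ((1 : Matrix (Fin 4) (Fin 4) ℂ) + euclideanGamma 3) p.2.2 q.2.2 *
                  ((if q.1.2 = -1 then (-1 : ℂ) else 1) * (star (A q.1.1 q.1.2 3 : Matrix (Fin 3) (Fin 3) ℂ)) p.2.1 q.2.1)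
              else 0));
    let dfc2 := fun (A : ZMod L → ZMod L → Fin 4 → Matrix.unitaryGroup (Fin 3) ℂ) (a b : ZMod L) =>
      3 - ((A a b 2 : Matrix (Fin 3) (Fin 3) ℂ) * (A (a + 1) b 3 : Matrix (Fin 3) (Fin 3) ℂ) *
        star (A a (b + 1) 2 : Matrix (Fin 3) (Fin 3) ℂ) * star (A a b 3 : Matrix (Fin 3) (Fin 3) ℂ)).trace.re;
    ‖(fD A m ω₀ ω₁).det‖ ≤
      Real.exp (1 / (L : ℝ) ^ 2 - c * (∑ ab ∈ (Finset.univ : Finset (ZMod L × ZMod L)).filter (fun ab => dfc2 A ab.1 ab.2 < δ), dfc2 A ab.1 ab.2)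
        + C * (((Finset.univ : Finset (ZMod L × ZMod L)).filter (fun ab => δ ≤ dfc2 A ab.1 ab.2)).card : ℝ)) *
      ‖(fD (fun _ _ _ => 1) m ω₀ ω₁).det‖) :
    ∃ ε δ c K C : ℝ, 0 < ε ∧ 0 < δ ∧ 0 < c ∧ ∃ L₀ : ℕ, ∀ (L : ℕ) [NeZero L], Odd L → L₀ ≤ L →
    ∀ (A : ZMod L → ZMod L → Fin 4 → Matrix.unitaryGroup (Fin 3) ℂ) (m : ℝ), |m| ≤ ε →
    let lift := fun (A : ZMod L → ZMod L → Fin 4 → Matrix.unitaryGroup (Fin 3) ℂ) (e : Edge 4 L) =>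
      if e.2 = 0 ∨ e.2 = 1 then (if e.1 e.2 = -1 then (-1 : Matrix.unitaryGroup (Fin 3) ℂ) else 1)
      else (if e.1 e.2 = -1 then -(A (e.1 2) (e.1 3) e.2) else A (e.1 2) (e.1 3) e.2);
    let T := fun e : Edge 4 L => if e.1 e.2 = -1 then (-1 : Matrix.unitaryGroup (Fin 3) ℂ) else 1;
    let dfc2 := fun (A : ZMod L → ZMod L → Fin 4 → Matrix.unitaryGroup (Fin 3) ℂ) (a b : ZMod L) =>
      3 - ((A a b 2 : Matrix (Fin 3) (Fin 3) ℂ) * (A (a + 1) b 3 : Matrix (Fin 3) (Fin 3) ℂ) *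
        star (A a (b + 1) 2 : Matrix (Fin 3) (Fin 3) ℂ) * star (A a b 3 : Matrix (Fin 3) (Fin 3) ℂ)).trace.re;
    ‖(wilsonDirac (unitaryFundamentalRep (Fin 3) ℂ) (lift A) m 1).det‖ ≤
      Real.exp (K - c * (L : ℝ) ^ 2 * (∑ ab ∈ (Finset.univ : Finset (ZMod L × ZMod L)).filter (fun ab => dfc2 A ab.1 ab.2 < δ), dfc2 A ab.1 ab.2)
        + C * (L : ℝ) ^ 2 * (((Finset.univ : Finset (ZMod L × ZMod L)).filter (fun ab => δ ≤ dfc2 A ab.1 ab.2)).card : ℝ)) *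
      ‖(wilsonDirac (unitaryFundamentalRep (Fin 3) ℂ) T m 1).det‖ :=
  TwoStaticGain.main
    (fun L _ A m => (wilsonDirac (unitaryFundamentalRep (Fin 3) ℂ)
      ((fun (A : ZMod L → ZMod L → Fin 4 → Matrix.unitaryGroup (Fin 3) ℂ) (e : Edge 4 L) =>
        if e.2 = 0 ∨ e.2 = 1 then (if e.1 e.2 = -1 then (-1 : Matrix.unitaryGroup (Fin 3) ℂ) else 1)
        else (if e.1 e.2 = -1 then -(A (e.1 2) (e.1 3) e.2) else A (e.1 2) (e.1 3) e.2)) A) m 1).det)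
    (fun L _ m => (wilsonDirac (unitaryFundamentalRep (Fin 3) ℂ)
      (fun e : Edge 4 L => if e.1 e.2 = -1 then (-1 : Matrix.unitaryGroup (Fin 3) ℂ) else 1) m 1).det)
    (fun L _ A m ω₀ ω₁ => ((fun (A : ZMod L → ZMod L → Fin 4 → Matrix.unitaryGroup (Fin 3) ℂ) (m ω₀ ω₁ : ℝ) =>
      Matrix.of fun (p q : (ZMod L × ZMod L) × Fin 3 × Fin 4) =>
        (if p.1 = q.1 ∧ p.2.1 = q.2.1 then
            (((m + 4 - Real.cos ω₀ - Real.cos ω₁ : ℝ) : ℂ) * (1 : Matrix (Fin 4) (Fin 4) ℂ) p.2.2 q.2.2 +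
              Complex.I * (((Real.sin ω₀ : ℝ) : ℂ) * euclideanGamma 0 p.2.2 q.2.2 +
                ((Real.sin ω₁ : ℝ) : ℂ) * euclideanGamma 1 p.2.2 q.2.2))
          else 0) -
          (1 / 2 : ℂ) *
            ((if q.1 = (p.1.1 + 1, p.1.2) then
                ((1 : Matrix (Fin 4) (Fin 4) ℂ) - euclideanGamma 2) p.2.2 q.2.2 *
                  ((if p.1.1 = -1 then (-1 : ℂ) else 1) * (A p.1.1 p.1.2 2 : Matrix (Fin 3) (Fin 3) ℂ) p.2.1 q.2.1)
              else 0) +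
             (if p.1 = (q.1.1 + 1, q.1.2) then
                ((1 : Matrix (Fin 4) (Fin 4) ℂ) + euclideanGamma 2) p.2.2 q.2.2 *
                  ((if q.1.1 = -1 then (-1 : ℂ) else 1) * (star (A q.1.1 q.1.2 2 : Matrix (Fin 3) (Fin 3) ℂ)) p.2.1 q.2.1)
              else 0) +
             (if q.1 = (p.1.1, p.1.2 + 1) then
                ((1 : Matrix (Fin 4) (Fin 4) ℂ) - euclideanGamma 3) p.2.2 q.2.2 *
                  ((if p.1.2 = -1 then (-1 : ℂ) else 1) * (A p.1.1 p.1.2 3 : Matrix (Fin 3) (Fin 3) ℂ) p.2.1 q.2.1)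
              else 0) +
             (if p.1 = (q.1.1, q.1.2 + 1) then
                ((1 : Matrix (Fin 4) (Fin 4) ℂ) + euclideanGamma 3) p.2.2 q.2.2 *
                  ((if q.1.2 = -1 then (-1 : ℂ) else 1) * (star (A q.1.1 q.1.2 3 : Matrix (Fin 3) (Fin 3) ℂ)) p.2.1 q.2.1)
              else 0))) A m ω₀ ω₁).det)
    (fun L A a b => 3 - ((A a b 2 : Matrix (Fin 3) (Fin 3) ℂ) * (A (a + 1) b 3 : Matrix (Fin 3) (Fin 3) ℂ) *
      star (A a (b + 1) 2 : Matrix (Fin 3) (Fin 3) ℂ) * star (A a b 3 : Matrix (Fin 3) (Fin 3) ℂ)).trace.re)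
    (fun L _ m => by simp only [ite_self]) hF hD hG


/-- **S5 `stub_twoStaticGain`** — the DOUBLY STATIC GAIN: for a 2D `U(3)` field lifted statically (antiperiodic pattern on the
`0,1`-links), the Wilson determinant on the odd four-torus gains `c·L²` per unit of good `(2,3)`-deficit and pays `C·L²` per bad
plaquette. Assembly (worker): `stub_frequencyFactorisation` (product over the `L²` frequencies, also for the free field `lift 1 = T`),
`stub_frequencyDiamagnetism` at the light frequencies, `stub_heavyFrequencyGain` at the heavy ones, and the count
`#{k : cos(π(2k+1)/L) ≤ −7/10}² ≥ L²/40` for `L ≥ L₀`. [difficulty: M] -/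
theorem stub_twoStaticGain : ∃ ε δ c K C : ℝ, 0 < ε ∧ 0 < δ ∧ 0 < c ∧ ∃ L₀ : ℕ, ∀ (L : ℕ) [NeZero L], Odd L → L₀ ≤ L →
    ∀ (A : ZMod L → ZMod L → Fin 4 → Matrix.unitaryGroup (Fin 3) ℂ) (m : ℝ), |m| ≤ ε →
    let lift := fun (A : ZMod L → ZMod L → Fin 4 → Matrix.unitaryGroup (Fin 3) ℂ) (e : Edge 4 L) =>
      if e.2 = 0 ∨ e.2 = 1 then (if e.1 e.2 = -1 then (-1 : Matrix.unitaryGroup (Fin 3) ℂ) else 1)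
      else (if e.1 e.2 = -1 then -(A (e.1 2) (e.1 3) e.2) else A (e.1 2) (e.1 3) e.2);
    let T := fun e : Edge 4 L => if e.1 e.2 = -1 then (-1 : Matrix.unitaryGroup (Fin 3) ℂ) else 1;
    let dfc2 := fun (A : ZMod L → ZMod L → Fin 4 → Matrix.unitaryGroup (Fin 3) ℂ) (a b : ZMod L) =>
      3 - ((A a b 2 : Matrix (Fin 3) (Fin 3) ℂ) * (A (a + 1) b 3 : Matrix (Fin 3) (Fin 3) ℂ) *
        star (A a (b + 1) 2 : Matrix (Fin 3) (Fin 3) ℂ) * star (A a b 3 : Matrix (Fin 3) (Fin 3) ℂ)).trace.re;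
    ‖(wilsonDirac (unitaryFundamentalRep (Fin 3) ℂ) (lift A) m 1).det‖ ≤
      Real.exp (K - c * (L : ℝ) ^ 2 * (∑ ab ∈ (Finset.univ : Finset (ZMod L × ZMod L)).filter (fun ab => dfc2 A ab.1 ab.2 < δ), dfc2 A ab.1 ab.2)
        + C * (L : ℝ) ^ 2 * (((Finset.univ : Finset (ZMod L × ZMod L)).filter (fun ab => δ ≤ dfc2 A ab.1 ab.2)).card : ℝ)) *
      ‖(wilsonDirac (unitaryFundamentalRep (Fin 3) ℂ) T m 1).det‖ := by
  classical
  exact twoStaticGain_of_frequencyStubs stub_frequencyFactorisation stub_frequencyDiamagnetism stub_heavyFrequencyGain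

/-! `stub_staticCovariance`: LANDED (imported above). -/

/-! `stub_staticReduction`: LANDED (imported above). -/

/-- **Stub 7 — `oddHalf` (the crux ON ODD TORI), now DERIVED from the static route (v21).** Verbatim the crux with
`Odd L →` inserted. -/
theorem stub_oddHalf :
    ∃ ε δ c₁ K C : ℝ, 0 < ε ∧ 0 < δ ∧ 0 < c₁ ∧ ∃ L₀ : ℕ, ∀ (L : ℕ) [NeZero L], Odd L → L₀ ≤ L → let apDet : Literature.MathematicalPhysics.QuantumFieldTheory.GaugeConfig 4 L (Matrix.specialUnitaryGroup (Fin 3) ℂ) → ℝ → ℂ := fun U m => Literature.MathematicalPhysics.QuantumLattice.fermionDet (Literature.MathematicalPhysics.QuantumLattice.wilsonDirac (Literature.MathematicalPhysics.QuantumLattice.unitaryFundamentalRep (Fin 3) ℂ) (fun e => if e.1 e.2 = -1 then -(⟨(U e).1, Matrix.specialUnitaryGroup_le_unitaryGroup (U e).2⟩ : Matrix.unitaryGroup (Fin 3) ℂ) else ⟨(U e).1, Matrix.specialUnitaryGroup_le_unitaryGroup (U e).2⟩) m 1); let dfc : Literature.MathematicalPhysics.QuantumFieldTheory.GaugeConfig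 4 L (Matrix.specialUnitaryGroup (Fin 3) ℂ) → Literature.MathematicalPhysics.QuantumFieldTheory.Plaquette 4 L → ℝ := fun U p => 3 - (Literature.MathematicalPhysics.QuantumLattice.fundamentalRep (Fin 3) (Literature.MathematicalPhysics.QuantumFieldTheory.plaquetteHolonomy U p.1 p.2.1.1 p.2.1.2)).trace.re; ∀ m : ℝ, |m| ≤ ε → ∀ U : Literature.MathematicalPhysics.QuantumFieldTheory.GaugeConfig 4 L (Matrix.specialUnitaryGroup (Fin 3) ℂ), ‖apDet U m‖ ≤ Real.exp (K - c₁ * (∑ p ∈ Finset.univ.filter (fun p => dfc U p < δ), dfc U p) + C * ((Finset.univ.filter (fun p => δ ≤ dfc U p)).card : ℝ)) * ‖apDet 1 m‖ :=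
  stub_staticReduction (stub_staticCovariance stub_twoStaticGain)

/-! ## The two halves of the crux (local abbreviations of the composition; NOT stubs) -/

/-- The crux restricted to even tori (verbatim, `Even L →` inserted). -/
def EvenHalf : Prop :=
    ∃ ε δ c₁ K C : ℝ, 0 < ε ∧ 0 < δ ∧ 0 < c₁ ∧ ∃ L₀ : ℕ, ∀ (L : ℕ) [NeZero L], Even L → L₀ ≤ L → let apDet : Literature.MathematicalPhysics.QuantumFieldTheory.GaugeConfig 4 L (Matrix.specialUnitaryGroup (Fin 3) ℂ) → ℝ → ℂ := fun U m => Literature.MathematicalPhysics.QuantumLattice.fermionDet (Literature.MathematicalPhysics.QuantumLattice.wilsonDirac (Literature.MathematicalPhysics.QuantumLattice.unitaryFundamentalRep (Fin 3) ℂ) (fun e => if e.1 e.2 = -1 then -(⟨(U e).1, Matrix.specialUnitaryGroup_le_unitaryGroup (U e).2⟩ : Matrix.unitaryGroup (Fin 3) ℂ) else ⟨(U e).1, Matrix.specialUnitaryGroup_le_unitaryGroup (U e).2⟩) m 1); let dfc : Literature.MathematicalPhysics.QuantumFieldTheory.GaugeConfig 4 L (Matrix.specialUnitaryGroup (Fin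 3) ℂ) → Literature.MathematicalPhysics.QuantumFieldTheory.Plaquette 4 L → ℝ := fun U p => 3 - (Literature.MathematicalPhysics.QuantumLattice.fundamentalRep (Fin 3) (Literature.MathematicalPhysics.QuantumFieldTheory.plaquetteHolonomy U p.1 p.2.1.1 p.2.1.2)).trace.re; ∀ m : ℝ, |m| ≤ ε → ∀ U : Literature.MathematicalPhysics.QuantumFieldTheory.GaugeConfig 4 L (Matrix.specialUnitaryGroup (Fin 3) ℂ), ‖apDet U m‖ ≤ Real.exp (K - c₁ * (∑ p ∈ Finset.univ.filter (fun p => dfc U p < δ), dfc U p) + C * ((Finset.univ.filter (fun p => δ ≤ dfc U p)).card : ℝ)) * ‖apDet 1 m‖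

/-- The crux restricted to odd tori (verbatim, `Odd L →` inserted) — the statement of `stub_oddHalf`. -/
def OddHalf : Prop :=
    ∃ ε δ c₁ K C : ℝ, 0 < ε ∧ 0 < δ ∧ 0 < c₁ ∧ ∃ L₀ : ℕ, ∀ (L : ℕ) [NeZero L], Odd L → L₀ ≤ L → let apDet : Literature.MathematicalPhysics.QuantumFieldTheory.GaugeConfig 4 L (Matrix.specialUnitaryGroup (Fin 3) ℂ) → ℝ → ℂ := fun U m => Literature.MathematicalPhysics.QuantumLattice.fermionDet (Literature.MathematicalPhysics.QuantumLattice.wilsonDirac (Literature.MathematicalPhysics.QuantumLattice.unitaryFundamentalRep (Fin 3) ℂ) (fun e => if e.1 e.2 = -1 then -(⟨(U e).1, Matrix.specialUnitaryGroup_le_unitaryGroup (U e).2⟩ : Matrix.unitaryGroup (Fin 3) ℂ) else ⟨(U e).1, Matrix.specialUnitaryGroup_le_unitaryGroup (U e).2⟩) m 1); let dfc : Literature.MathematicalPhysics.QuantumFieldTheory.GaugeConfig 4 L (Matrix.specialUnitaryGroup (Fin 3) ℂ) → Literature.MathematicalPhysics.QuantumFieldTheory.Plaquette 4 L → ℝ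 := fun U p => 3 - (Literature.MathematicalPhysics.QuantumLattice.fundamentalRep (Fin 3) (Literature.MathematicalPhysics.QuantumFieldTheory.plaquetteHolonomy U p.1 p.2.1.1 p.2.1.2)).trace.re; ∀ m : ℝ, |m| ≤ ε → ∀ U : Literature.MathematicalPhysics.QuantumFieldTheory.GaugeConfig 4 L (Matrix.specialUnitaryGroup (Fin 3) ℂ), ‖apDet U m‖ ≤ Real.exp (K - c₁ * (∑ p ∈ Finset.univ.filter (fun p => dfc U p < δ), dfc U p) + C * ((Finset.univ.filter (fun p => δ ≤ dfc U p)).card : ℝ)) * ‖apDet 1 m‖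

/-! ## Merging the halves (sorry-free) -/

/-- The crux from its even and odd halves, by `exponent_mono` with the common constants
`ε = min, δ = min, c₁ = min, K = max, C = max ⊔ 0, L₀ = max`. -/
theorem crux_of_halves (hE : EvenHalf) (hO : OddHalf) :
    Theses.QuarksAsStableAction.CriticalLineDiamagnetism := by
  obtain ⟨ε₁, δ₁, c₁, K₁, C₁, hε₁, hδ₁, hc₁, L₁, h₁⟩ := hE
  obtain ⟨ε₂, δ₂, c₂, K₂, C₂, hε₂, hδ₂, hc₂, L₂, h₂⟩ := hO
  refine ⟨min ε₁ ε₂, min δ₁ δ₂, min c₁ c₂, max K₁ K₂, max (max C₁ C₂) 0, lt_min hε₁ hε₂, lt_min hδ₁ hδ₂,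
    lt_min hc₁ hc₂, max L₁ L₂, ?_⟩
  intro L _ hL apDet dfc m hm U
  show ‖cruxDet U m‖ ≤ Real.exp (max K₁ K₂ - min c₁ c₂ * (∑ p ∈ Finset.univ.filter (fun p => cruxDfc U p < min δ₁ δ₂),
    cruxDfc U p) + max (max C₁ C₂) 0 * ((Finset.univ.filter (fun p => min δ₁ δ₂ ≤ cruxDfc U p)).card : ℝ)) *
      ‖cruxDet 1 m‖
  have hd : ∀ p : Plaquette 4 L, 0 ≤ cruxDfc U p := cruxDfc_nonneg U
  rcases Nat.even_or_odd L with hpar | hpar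
  · have h : ‖cruxDet U m‖ ≤ Real.exp (K₁ - c₁ * (∑ p ∈ Finset.univ.filter (fun p => cruxDfc U p < δ₁), cruxDfc U p) +
        C₁ * ((Finset.univ.filter (fun p => δ₁ ≤ cruxDfc U p)).card : ℝ)) * ‖cruxDet 1 m‖ :=
      h₁ L hpar (le_trans (le_max_left _ _) hL) m (le_trans hm (min_le_left _ _)) U
    refine le_trans h (mul_le_mul_of_nonneg_right (Real.exp_le_exp.2 ?_) (norm_nonneg _))
    exact exponent_mono Finset.univ (cruxDfc U) hd (min_le_left _ _) (min_le_left _ _)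
      (le_of_lt (lt_min hc₁ hc₂)) (le_max_left _ _) (le_trans (le_max_left _ _) (le_max_left _ _))
      (le_max_right _ _)
  · have h : ‖cruxDet U m‖ ≤ Real.exp (K₂ - c₂ * (∑ p ∈ Finset.univ.filter (fun p => cruxDfc U p < δ₂), cruxDfc U p) +
        C₂ * ((Finset.univ.filter (fun p => δ₂ ≤ cruxDfc U p)).card : ℝ)) * ‖cruxDet 1 m‖ :=
      h₂ L hpar (le_trans (le_max_right _ _) hL) m (le_trans hm (min_le_right _ _)) U
    refine le_trans h (mul_le_mul_of_nonneg_right (Real.exp_le_exp.2 ?_) (norm_nonneg _))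
    exact exponent_mono Finset.univ (cruxDfc U) hd (min_le_right _ _) (min_le_right _ _)
      (le_of_lt (lt_min hc₁ hc₂)) (le_max_right _ _) (le_trans (le_max_right _ _) (le_max_left _ _))
      (le_max_right _ _)


/-! ## The composition (PROVED, no `sorry` outside the stub): the even half (tree theorem) and the odd stub imply the crux, by name -/

/-- **The crux from the line.** `CriticalLineDiamagnetism` from the tree theorem `stub_evenHalf` (the even half, p142113) and the one
open stub `stub_oddHalf` (the crux on odd tori), merged by `crux_of_halves`. -/
theorem CriticalLineDiamagnetism_of : Theses.QuarksAsStableAction.CriticalLineDiamagnetism :=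
  crux_of_halves stub_evenHalf stub_oddHalf

end Summit.QuantumFields.QCD.Cruxes.CriticalLineDiamagnetism.ChessboardCellGain
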